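import Summits.BirchSwinnertonDyer.BirchSwinnertonDyer.Theorems.KatoDescentPotSupersingularReducibleLayerZeroDoors
import Literature.NumberTheory.NumberFields.ClassGroupEigenHomRelativeNorm
import HarnessLib

/-!
# THE RELATIVE-CLASS-NUMBER DOOR of crux M: the layer-zero eigen-test on the character field `ℚ(χ_i)` of a reducible row is
# discharged by ONE integer, `p ∤ #ker (N : Cl ℚ(χ_i) → Cl ℚ(χ_i)^σ)` for a `σ` acting on the line by `a ≢ 1` — for the ODD
# character and `σ` = complex conjugation this is `p ∤ h⁻(ℚ(χ_odd)) = h/h⁺`, a number the analytic class number formula gives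
# EXACTLY (no GRH)  (route-free helper for crux M = stmt-BirchSwinnertonDyer-19196 `ReducibleKatoMember`, K9 / K8-t′;
# seat `bsd-potss-rkm` g40)

WHY.  After g39 the `μ`-input of crux M's kernel chain on a reducible row (`0 → C → W[p] → W[p]/C → 0`, characters `χ₁`, `χ₂`,
`χ₁χ₂ = ω`) is decided at LAYER ZERO per character: statement (A) at `(W, p)` follows from, per side `i`, the EIGEN-TEST «every
additive `μ : Cl(𝓞_{K_i}) → 𝔽_p` with `μ([σ̄I]) = a·μ([I])` whenever `τ|_{K_i} = σ̄`, `τ•P_i ≡ a•P_i`, vanishes» on a subfield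
`K_i ⊆ ℚ(χ₁,χ₂)` fixing a generator, plus `V_i^{D_p} = 0`.  The census had to decide the eigen-test from the full class group of
`K_i = ℚ(χ_i)` (`bnfinit` + `bnfcertify`), which is out of reach (GRH only) for the 24 rows at `p ∈ {11, 17}` whose character fields
have degree 10 and 16.  THIS FILE replaces the class group by ONE INTEGER: by the tree theorem
`Literature.NumberTheory.NumberFields.addMonoidHom_classGroup_eq_zero_of_smul_ne_one_of_not_dvd_card_ker` (Lang, *Cyclotomic
Fields* Ch. 3 §4, Thm. 4.4, proof: `c·(σc)⁻¹ ∈ ker N_{K/K^σ}`), a `σ`-eigenfunctional with eigenvalue `a ≢ 1 (mod p)` vanishes as soon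
as `p ∤ #ker (N_{K_i/K_i^σ} : Cl_{K_i} → Cl_{K_i^σ})`.  Exactly one of `χ₁, χ₂` is odd; on that side take `σ` = complex conjugation
(`a ≡ −1`): `K_i^σ = K_i⁺` and `#ker N = h(K_i)/h(K_i⁺) = h⁻(K_i)` (norm surjective for CM fields, tree
`IsCMField.card_ker_classGroupNorm_mul_card`), and `h⁻` of an imaginary abelian field is given EXACTLY by the analytic class number
formula `h⁻ = Q w ∏_{χ odd} (−½ B_{1,χ})` (Hasse; Washington Thm. 4.17) — generalized Bernoulli numbers, rational arithmetic, no GRH.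

* §1 `eigenTest_of_witness_of_not_dvd_card_ker` — the BRIDGE, for any Galois extension of number fields `K₁/k` and abstract
  compatibility predicates `R τ σ`, `S τ a`: one witness `(τ₀, σ₀, a₀)` with `R τ₀ σ₀`, `S τ₀ a₀`, `a₀ ≢ 1 (mod p)` and
  `p ∤ #ker N_{K₁/K₁^{σ₀}}` gives the eigen-test «`∀ μ, (∀ τ σ a, R τ σ → S τ a → μ σ-equivariant with eigenvalue a) → μ = 0`».
* §2 **`fineSelmerDual_moduleFinite_of_not_irreducible_of_relNorm_or_layerZero_or_doors`** — THE PER-ROW DOOR over `ℚ`: g39's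
  door `ReducibleFineSelmerLayerZero.fineSelmerDual_moduleFinite_of_not_irreducible_of_layerZero_or_doors` with, per side, ONE MORE
  disjunct in front: the relative-norm witness package «`K_i ⊆ ℚ(χ₁,χ₂)` fixing the generator, `σ₀ ∈ Gal(K_i/ℚ)` lifted by `τ₀ ∈ Γ_ℚ`
  acting on the generator by `a₀ ≢ 1`, `p ∤ #ker N_{K_i/K_i^{σ₀}}`» `∧ V_i^{D_p} = 0`.
* §3 `doors_of_classNumberPExp_lt` — the TOWER side in class-number-EXPONENT form: «for every cyclotomic `ℤ_p`-extension `κ` of `K_i`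
  some layer has `e_j = ord_p h((K_i)_j) < p^j − 1`» implies g38/g39's three-way `μ`-door disjunct (rank ≤ exponent, tree
  `classGroupPRank_le_classNumberPExp` + conjA-anchor g20's one-layer small-rank criterion); `e_j` is the integer the exact `h⁻` census
  certifies (`h((K_i)_j) = h⁻·h((K_i)_j⁺)`, `p ∤ h((K_i)_j⁺)` by Iwasawa 1956 on `K_i⁺`).

CENSUS (kit job of this generation, evidence on the item; EXACT, no GRH): the relative class numbers `h⁻` of the imaginary character
fields of the 42 GRH rows of g39's census (K8-t′ X3 reducible, `p ≥ 5`) at layers 0–2 and of the 11 imaginary quadratic mirrors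
`ℚ(√δ)`, `3` split, carrying the GRH residue of the K9 X3 reducible rows at `p = 3` (g36/g37), at layers 0–3.
HONEST FRAMING.  Theorems only; route-free; closes nothing: crux M stays cite-level over {Fine, H2X⁺, modularity} and, class-wide, the
`μ`-input `H_IC`; no class number is computed in Lean — the displayed integers are certified outside the kernel (analytic class number
formula / `bnfcertify`); BSD is proved for no curve.
References: [Lang1990] Ch. 3 §4 Thm. 4.3, 4.4; [Washington1997] Thm. 4.17, §10.2, §13.3; [CoatesSujatha2005] Thm. 3.4, Cor. 3.6;
[DeoRaySujatha2023] §3 Thm. 3.8; [Fukuda1994] Thm. 1; [Wuthrich2014] L. 14.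
-/

-- the summit and its single problem are both named `BirchSwinnertonDyer` (registry layout D-0017)
set_option linter.dupNamespace false
set_option autoImplicit false

noncomputable section

open scoped Classical Pointwise NumberField nonZeroDivisors
open Field NumberField IsDedekindDomain IntermediateField WeierstrassCurve
open Literature.NumberTheory.EllipticCurves Literature.NumberTheory.EllipticCurves.GreenbergSelmer
open Literature.NumberTheory.GaloisRepresentations Literature.NumberTheory.IwasawaTheory Literature.NumberTheory.NumberFields
open Literature.NumberTheory.EllipticCurves.FineSelmerReducibleIsotypic Literature.NumberTheory.EllipticCurves.CoatesSujatha2005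
open Literature.NumberTheory.EllipticCurves.ZpExtension
open Summit.BirchSwinnertonDyer.BirchSwinnertonDyer.Theorems
open Summit.BirchSwinnertonDyer.BirchSwinnertonDyer.Theorems.ReducibleFineSelmerCharacterFields
open Summit.BirchSwinnertonDyer.BirchSwinnertonDyer.Theorems.ReducibleFineSelmerLayerZero

namespace Summit.BirchSwinnertonDyer.BirchSwinnertonDyer.Theorems.ReducibleFineSelmerRelativeClassNumber

/-! ## §1 The bridge: one `σ`-witness with `a ≢ 1` and `p ∤ #ker N_{K₁/K₁^σ}` gives the eigen-test -/

/-- **The relative-norm witness discharges the layer-zero eigen-test.**  `K₁/k` a Galois extension of number fields; `R τ σ` and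
`S τ a` arbitrary compatibility predicates (in the doors: «`τ` restricts to `σ` on `K₁`» and «`τ` acts on the generator by `a`»).
If ONE witness `τ₀, σ₀, a₀` has `R τ₀ σ₀`, `S τ₀ a₀`, `a₀ ≢ 1 (mod p)` and `p ∤ #ker (N : Cl_{K₁} → Cl_{K₁^{σ₀}})`, then every additive
`μ : Cl_{K₁} → ZMod p` which is `σ`-equivariant with eigenvalue `a` for every compatible triple `(τ, σ, a)` vanishes — because it
is in particular a `σ₀`-eigenfunctional with eigenvalue `a₀ ≠ 1`, killed by Lang's `c·(σ₀c)⁻¹ ∈ ker N`.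
[cite: Lang1990, Ch. 3 §4, Thm. 4.4 (proof)] [cite: Washington1997, §10.2 (Thm. 10.3)] -/
theorem eigenTest_of_witness_of_not_dvd_card_ker {k K₁ : Type} [Field k] [NumberField k] [Field K₁] [NumberField K₁]
    [Algebra k K₁] [IsGalois k K₁] {Γ : Type*} (R : Γ → (K₁ ≃ₐ[k] K₁) → Prop) (S : Γ → ℕ → Prop)
    {p : ℕ} [Fact p.Prime] (τ₀ : Γ) (σ₀ : K₁ ≃ₐ[k] K₁) (a₀ : ℕ) (hR : R τ₀ σ₀) (hS : S τ₀ a₀) (ha : ¬ a₀ ≡ 1 [MOD p])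
    (hker : ¬ p ∣ Nat.card (classGroupNorm ↥(fixedField (Subgroup.zpowers σ₀)) K₁).ker) :
    ∀ μ : Additive (ClassGroup (𝓞 K₁)) →+ ZMod p,
      (∀ (τ : Γ) (σ : K₁ ≃ₐ[k] K₁) (a : ℕ), R τ σ → S τ a →
        ∀ (I J : (Ideal (𝓞 K₁))⁰),
          (J : Ideal (𝓞 K₁)) = (I : Ideal (𝓞 K₁)).map (AmbiguousClass.intAut σ : 𝓞 K₁ →+* 𝓞 K₁) →
          μ (Additive.ofMul (ClassGroup.mk0 J)) = a • μ (Additive.ofMul (ClassGroup.mk0 I))) →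
      μ = 0 := by
  intro μ hμ
  -- `σ₀` as an automorphism over its own fixed field `E = K₁^{σ₀}`
  let σE : K₁ ≃ₐ[↥(fixedField (Subgroup.zpowers σ₀))] K₁ :=
    { σ₀.toRingEquiv with
      commutes' := fun e => by
        obtain ⟨e, he⟩ := e
        exact (IntermediateField.mem_fixedField_iff (Subgroup.zpowers σ₀) e).mp he σ₀ (Subgroup.mem_zpowers σ₀) }
  have hint : (AmbiguousClass.intAut σE : 𝓞 K₁ →+* 𝓞 K₁) = (AmbiguousClass.intAut σ₀ : 𝓞 K₁ →+* 𝓞 K₁) := rfl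
  refine addMonoidHom_classGroup_eq_zero_of_smul_ne_one_of_not_dvd_card_ker ↥(fixedField (Subgroup.zpowers σ₀)) K₁ σE
    hker μ a₀ ha ?_
  intro I J hJ
  rw [hint] at hJ
  exact hμ τ₀ σ₀ a₀ hR hS I J hJ

/-! ## §2 THE PER-ROW DOOR over `ℚ`: per side, relative-norm witness OR layer-zero eigen-test OR g38's three-way `μ`-door -/

/-- **THE RELATIVE-CLASS-NUMBER-OR-LAYER-ZERO-OR-μ PER-ROW DOOR: (A) at `(W, p)` on a reducible row over `ℚ`.**  Side 1 (`χ₁` on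
`C`, field `ℚ(P)`): EITHER the relative-norm witness package (a subfield `K₁ ⊆ ℚ(χ₁,χ₂)` fixing a generator `P` of `C`; `σ₀ ∈ Gal(K₁/ℚ)`
lifted by `τ₀ ∈ Γ_ℚ` with `τ₀•P = a₀•P`, `a₀ ≢ 1 (mod p)`; `p ∤ #ker (N : Cl_{K₁} → Cl_{K₁^{σ₀}})`) together with `C^{D_p} = 0`, OR
g39's side hypothesis verbatim (layer-zero eigen-test ∧ `C^{D_p} = 0`, or the three-way `μ`-door at `ℚ̄^{fixingSubgroup C}`); side 2
(`χ₂` on `W[p]/C`, field `ℚ(P′)`): the same modulo `C`.  Conclusion: statement (A) at `(W, p)`.  On the ODD side with `σ₀` = complex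
conjugation (`a₀ ≡ −1`) the integer is `h⁻(ℚ(χ_odd))`, exact by the analytic class number formula.
[cite: Lang1990, Ch. 3 §4, Thm. 4.3 and Thm. 4.4] [cite: CoatesSujatha2005, §3 Thm. 3.4, Lemma 3.8 and Cor. 3.6]
[cite: DeoRaySujatha2023, §3 Thm. 3.8 (c2), (c3) and §5 Lemma 5.1] [cite: Washington1997, Thm. 4.17, §10.2 and §13.3 Prop. 13.22–13.23] -/
theorem fineSelmerDual_moduleFinite_of_not_irreducible_of_relNorm_or_layerZero_or_doors {p : ℕ} [hp : Fact p.Prime] (hp2 : p ≠ 2)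
    (W : WeierstrassCurve ℚ) [W.IsElliptic] (κ : ZpExtension ℚ p) (hκ : κ.IsCyclotomic)
    (C : AddSubgroup (W.geomTorsion ((p : ℕ) : ℤ)))
    (hC : ∀ (σ : absoluteGaloisGroup ℚ) (x : W.geomTorsion ((p : ℕ) : ℤ)), x ∈ C → σ • x ∈ C) (h1 : C ≠ ⊥) (h2 : C ≠ ⊤)
    (side₁ : haveI : NeZero p := ⟨hp.out.ne_zero⟩
      haveI := isGalois_borelField (W := W) hC
      ((∃ (K₁ : IntermediateField ℚ (W.borelField C)) (_ : NumberField K₁) (P : W.geomTorsion ((p : ℕ) : ℤ))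
          (σ₀ : K₁ ≃ₐ[ℚ] K₁) (τ₀ : absoluteGaloisGroup ℚ) (a₀ : ℕ),
          P ∈ C ∧ P ≠ 0 ∧
          (∀ τ : absoluteGaloisGroup ℚ,
            (∀ x : K₁, absRestrictNormalHom (W.borelField C) τ (x : W.borelField C) = x) → τ • P = P) ∧
          (∀ x : K₁, absRestrictNormalHom (W.borelField C) τ₀ (x : W.borelField C) = ((σ₀ x : K₁) : W.borelField C)) ∧
          τ₀ • P = a₀ • P ∧ ¬ a₀ ≡ 1 [MOD p] ∧
          ¬ p ∣ Nat.card (classGroupNorm ↥(fixedField (Subgroup.zpowers σ₀)) K₁).ker) ∧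
        (∀ v : HeightOneSpectrum (𝓞 ℚ), ((p : ℕ) : 𝓞 ℚ) ∈ v.asIdeal →
          ∀ w : W.geomTorsion ((p : ℕ) : ℤ), w ∈ C → (∀ d ∈ GreenbergSelmer.decomp v, d • w = w) → w = 0)) ∨
      ((∃ (K₁ : IntermediateField ℚ (W.borelField C)) (_ : NumberField K₁) (P : W.geomTorsion ((p : ℕ) : ℤ)),
          P ∈ C ∧ P ≠ 0 ∧
          (∀ τ : absoluteGaloisGroup ℚ,
            (∀ x : K₁, absRestrictNormalHom (W.borelField C) τ (x : W.borelField C) = x) → τ • P = P) ∧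
          (∀ μ : Additive (ClassGroup (𝓞 K₁)) →+ ZMod p,
            (∀ (τ : absoluteGaloisGroup ℚ) (σ : K₁ ≃ₐ[ℚ] K₁) (a : ℕ),
              (∀ x : K₁, absRestrictNormalHom (W.borelField C) τ (x : W.borelField C) = ((σ x : K₁) : W.borelField C)) →
              τ • P = a • P →
              ∀ (I J : (Ideal (𝓞 K₁))⁰),
                (J : Ideal (𝓞 K₁)) = (I : Ideal (𝓞 K₁)).map (AmbiguousClass.intAut σ : 𝓞 K₁ →+* 𝓞 K₁) →
                μ (Additive.ofMul (ClassGroup.mk0 J)) = a • μ (Additive.ofMul (ClassGroup.mk0 I))) →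
            μ = 0)) ∧
        (∀ v : HeightOneSpectrum (𝓞 ℚ), ((p : ℕ) : 𝓞 ℚ) ∈ v.asIdeal →
          ∀ w : W.geomTorsion ((p : ℕ) : ℤ), w ∈ C → (∀ d ∈ GreenbergSelmer.decomp v, d • w = w) → w = 0)) ∨
      ((¬ p ∣ Nat.card (ClassGroup (𝓞 ↥(fixedField (fixingSubgroup (absoluteGaloisGroup ℚ)
          (C : Set (W.geomTorsion ((p : ℕ) : ℤ)))) : IntermediateField ℚ (AlgebraicClosure ℚ)))) ∧
        ∃! v : HeightOneSpectrum (𝓞 ↥(fixedField (fixingSubgroup (absoluteGaloisGroup ℚ)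
          (C : Set (W.geomTorsion ((p : ℕ) : ℤ)))) : IntermediateField ℚ (AlgebraicClosure ℚ))),
          ((p : ℕ) : 𝓞 ↥(fixedField (fixingSubgroup (absoluteGaloisGroup ℚ)
            (C : Set (W.geomTorsion ((p : ℕ) : ℤ)))) : IntermediateField ℚ (AlgebraicClosure ℚ))) ∈ v.asIdeal) ∨
      ∀ κ₁ : ZpExtension ↥(fixedField (fixingSubgroup (absoluteGaloisGroup ℚ)
          (C : Set (W.geomTorsion ((p : ℕ) : ℤ)))) : IntermediateField ℚ (AlgebraicClosure ℚ)) p, κ₁.IsCyclotomic →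
        (∃ n : ℕ, classGroupPRank κ₁ (n + 1) = classGroupPRank κ₁ n) ∨ ∃ j : ℕ, classGroupPRank κ₁ j < p ^ j - 1))
    (side₂ : haveI : NeZero p := ⟨hp.out.ne_zero⟩
      haveI := isGalois_borelField (W := W) hC
      ((∃ (K₂ : IntermediateField ℚ (W.borelField C)) (_ : NumberField K₂) (P₂ : W.geomTorsion ((p : ℕ) : ℤ))
          (σ₀ : K₂ ≃ₐ[ℚ] K₂) (τ₀ : absoluteGaloisGroup ℚ) (a₀ : ℕ),
          P₂ ∉ C ∧
          (∀ τ : absoluteGaloisGroup ℚ,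
            (∀ x : K₂, absRestrictNormalHom (W.borelField C) τ (x : W.borelField C) = x) → τ • P₂ - P₂ ∈ C) ∧
          (∀ x : K₂, absRestrictNormalHom (W.borelField C) τ₀ (x : W.borelField C) = ((σ₀ x : K₂) : W.borelField C)) ∧
          τ₀ • P₂ - a₀ • P₂ ∈ C ∧ ¬ a₀ ≡ 1 [MOD p] ∧
          ¬ p ∣ Nat.card (classGroupNorm ↥(fixedField (Subgroup.zpowers σ₀)) K₂).ker) ∧
        (∀ v : HeightOneSpectrum (𝓞 ℚ), ((p : ℕ) : 𝓞 ℚ) ∈ v.asIdeal →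
          ∀ m : W.geomTorsion ((p : ℕ) : ℤ), (∀ d ∈ GreenbergSelmer.decomp v, d • m - m ∈ C) → m ∈ C)) ∨
      ((∃ (K₂ : IntermediateField ℚ (W.borelField C)) (_ : NumberField K₂) (P₂ : W.geomTorsion ((p : ℕ) : ℤ)),
          P₂ ∉ C ∧
          (∀ τ : absoluteGaloisGroup ℚ,
            (∀ x : K₂, absRestrictNormalHom (W.borelField C) τ (x : W.borelField C) = x) → τ • P₂ - P₂ ∈ C) ∧
          (∀ μ : Additive (ClassGroup (𝓞 K₂)) →+ ZMod p,
            (∀ (τ : absoluteGaloisGroup ℚ) (σ : K₂ ≃ₐ[ℚ] K₂) (a : ℕ),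
              (∀ x : K₂, absRestrictNormalHom (W.borelField C) τ (x : W.borelField C) = ((σ x : K₂) : W.borelField C)) →
              τ • P₂ - a • P₂ ∈ C →
              ∀ (I J : (Ideal (𝓞 K₂))⁰),
                (J : Ideal (𝓞 K₂)) = (I : Ideal (𝓞 K₂)).map (AmbiguousClass.intAut σ : 𝓞 K₂ →+* 𝓞 K₂) →
                μ (Additive.ofMul (ClassGroup.mk0 J)) = a • μ (Additive.ofMul (ClassGroup.mk0 I))) →
            μ = 0)) ∧
        (∀ v : HeightOneSpectrum (𝓞 ℚ), ((p : ℕ) : 𝓞 ℚ) ∈ v.asIdeal →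
          ∀ m : W.geomTorsion ((p : ℕ) : ℤ), (∀ d ∈ GreenbergSelmer.decomp v, d • m - m ∈ C) → m ∈ C)) ∨
      ((¬ p ∣ Nat.card (ClassGroup (𝓞 ↥(fixedField (fixingSubgroup (absoluteGaloisGroup ℚ)
          (Set.range fun y : W.geomTorsion ((p : ℕ) : ℤ) => y +ᵥ (C : Set (W.geomTorsion ((p : ℕ) : ℤ))))) :
            IntermediateField ℚ (AlgebraicClosure ℚ)))) ∧
        ∃! v : HeightOneSpectrum (𝓞 ↥(fixedField (fixingSubgroup (absoluteGaloisGroup ℚ)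
          (Set.range fun y : W.geomTorsion ((p : ℕ) : ℤ) => y +ᵥ (C : Set (W.geomTorsion ((p : ℕ) : ℤ))))) :
            IntermediateField ℚ (AlgebraicClosure ℚ))),
          ((p : ℕ) : 𝓞 ↥(fixedField (fixingSubgroup (absoluteGaloisGroup ℚ)
            (Set.range fun y : W.geomTorsion ((p : ℕ) : ℤ) => y +ᵥ (C : Set (W.geomTorsion ((p : ℕ) : ℤ))))) :
              IntermediateField ℚ (AlgebraicClosure ℚ))) ∈ v.asIdeal) ∨
      ∀ κ₂ : ZpExtension ↥(fixedField (fixingSubgroup (absoluteGaloisGroup ℚ)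
          (Set.range fun y : W.geomTorsion ((p : ℕ) : ℤ) => y +ᵥ (C : Set (W.geomTorsion ((p : ℕ) : ℤ))))) :
            IntermediateField ℚ (AlgebraicClosure ℚ)) p, κ₂.IsCyclotomic →
        (∃ n : ℕ, classGroupPRank κ₂ (n + 1) = classGroupPRank κ₂ n) ∨ ∃ j : ℕ, classGroupPRank κ₂ j < p ^ j - 1)) :
    ∃ (γ : absoluteGaloisGroup ℚ) (D : W.FineSelmerDualData κ γ),
      Module.Finite ℤ_[p] (RestrictScalars ℤ_[p] (IwasawaAlgebra p) D.X) := by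
  haveI : NeZero p := ⟨hp.out.ne_zero⟩
  haveI := isGalois_borelField (W := W) hC
  -- the Borel field is abelian over `ℚ`, so every intermediate field is Galois over `ℚ`
  have hV : Nat.card (W.geomTorsion ((p : ℕ) : ℤ)) = p ^ 2 := W.natCard_geomTorsion_eq_sq_of_charZero hp.out
  have hcard : Nat.card C = p := W.card_eq_of_ne_bot_of_ne_top hV h1 h2
  have hab : IsAbelianGalois ℚ ↥(W.borelField C) := isAbelianGalois_borelField (W := W) hC hcard hV
  refine fineSelmerDual_moduleFinite_of_not_irreducible_of_layerZero_or_doors hp2 W κ hκ C hC h1 h2 ?_ ?_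
  · rcases side₁ with ⟨⟨K₁, hK₁, P, σ₀, τ₀, a₀, hPC, hP0, hfix, hτσ, hτP, ha, hker⟩, hD⟩ | h
    · refine Or.inl ⟨⟨K₁, hK₁, P, hPC, hP0, hfix, ?_⟩, hD⟩
      haveI : IsAbelianGalois ℚ ↥K₁ := @IsAbelianGalois.tower_bot ℚ ↥K₁ ↥(W.borelField C) _ _ _ _ _ _ _ hab
      exact eigenTest_of_witness_of_not_dvd_card_ker
        (fun (τ : absoluteGaloisGroup ℚ) (σ : K₁ ≃ₐ[ℚ] K₁) =>
          ∀ x : K₁, absRestrictNormalHom (W.borelField C) τ (x : W.borelField C) = ((σ x : K₁) : W.borelField C))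
        (fun (τ : absoluteGaloisGroup ℚ) (a : ℕ) => τ • P = a • P) τ₀ σ₀ a₀ hτσ hτP ha hker
    · exact h
  · rcases side₂ with ⟨⟨K₂, hK₂, P₂, σ₀, τ₀, a₀, hP₂, hfix, hτσ, hτP, ha, hker⟩, hD⟩ | h
    · refine Or.inl ⟨⟨K₂, hK₂, P₂, hP₂, hfix, ?_⟩, hD⟩
      haveI : IsAbelianGalois ℚ ↥K₂ := @IsAbelianGalois.tower_bot ℚ ↥K₂ ↥(W.borelField C) _ _ _ _ _ _ _ hab
      exact eigenTest_of_witness_of_not_dvd_card_ker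
        (fun (τ : absoluteGaloisGroup ℚ) (σ : K₂ ≃ₐ[ℚ] K₂) =>
          ∀ x : K₂, absRestrictNormalHom (W.borelField C) τ (x : W.borelField C) = ((σ x : K₂) : W.borelField C))
        (fun (τ : absoluteGaloisGroup ℚ) (a : ℕ) => τ • P₂ - a • P₂ ∈ C) τ₀ σ₀ a₀ hτσ hτP ha hker
    · exact h

/-! ## §3 The tower side in class-number-EXPONENT form (the integer the exact `h⁻` census certifies) -/

/-- **`e_j < p^j − 1` at ONE layer gives the `μ`-door.**  For a number field `F` and a prime `p`: if for every cyclotomic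
`ℤ_p`-extension `κ` of `F` some layer `j` has class-number exponent `e_j(κ) = ord_p h(F_j) < p^j − 1`, then the three-way `μ`-door
disjunct «Fukuda stability ∨ one-layer small rank» of g38/g39's doors holds (with the small-rank alternative), since
`rank_p Cl(F_j) ≤ ord_p h(F_j)` (tree `classGroupPRank_le_classNumberPExp`).  Reading: `p = 3`, `j = 2`: `ord₃ h(F₂) ≤ 7`;
`p = 5`, `j = 1`: `ord₅ h(F₁) ≤ 3`, `j = 2`: `≤ 23`.  For an imaginary abelian `F` with `p ∤ h(F_j⁺)` (Iwasawa 1956 on `F⁺`) this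
integer is `ord_p h⁻(F_j)`, exact by the analytic class number formula.
[cite: Fukuda1994, Thm. 1 (proof, p. 264)] [cite: Washington1997, §13.3 Prop. 13.22–13.23 and Thm. 4.17] -/
theorem doors_of_classNumberPExp_lt {F : Type} [Field F] [NumberField F] {p : ℕ} [Fact p.Prime]
    (h : ∀ κF : ZpExtension F p, κF.IsCyclotomic → ∃ j : ℕ, classNumberPExp κF j < p ^ j - 1) :
    ∀ κF : ZpExtension F p, κF.IsCyclotomic →
      (∃ n : ℕ, classGroupPRank κF (n + 1) = classGroupPRank κF n) ∨ ∃ j : ℕ, classGroupPRank κF j < p ^ j - 1 := by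
  intro κF hκF
  obtain ⟨j, hj⟩ := h κF hκF
  exact Or.inr ⟨j, lt_of_le_of_lt (Literature.NumberTheory.IwasawaTheory.classGroupPRank_le_classNumberPExp κF j) hj⟩

/-- **One fixed layer `j` suffices** (the shape a record displays: a single inequality `e_j < p^j − 1` for every cyclotomic `κ`).
[cite: Fukuda1994, Thm. 1 (proof, p. 264)] [cite: Washington1997, §13.3 Prop. 13.23] -/
theorem doors_of_classNumberPExp_lt_at {F : Type} [Field F] [NumberField F] {p : ℕ} [Fact p.Prime] (j : ℕ)
    (h : ∀ κF : ZpExtension F p, κF.IsCyclotomic → classNumberPExp κF j < p ^ j - 1) :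
    ∀ κF : ZpExtension F p, κF.IsCyclotomic →
      (∃ n : ℕ, classGroupPRank κF (n + 1) = classGroupPRank κF n) ∨ ∃ j : ℕ, classGroupPRank κF j < p ^ j - 1 :=
  doors_of_classNumberPExp_lt fun κF hκF => ⟨j, h κF hκF⟩


/-! ## §4 The TWO-FIELD door in class-number-EXPONENT form (the shape of the exact `h⁻` census: two integers per row) -/

/-- **(A) at `(W, p)` on a reducible row from, per character field `ℚ(P)` / `ℚ(P′)`, EITHER Iwasawa 1956 (`p ∤ h`, one prime above `p`) OR ONE
class-number exponent `e_{j} = ord_p h(ℚ(χ_i)·ℚ_{j}) < p^{j} − 1` at a chosen layer `j_i` of the cyclotomic `ℤ_p`-tower** (g38's two-field door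
`ReducibleFineSelmerCharacterFields.fineSelmerDual_moduleFinite_of_not_irreducible_of_characterFields_doors` fed through `rank_p ≤ ord_p h` and
conjA-anchor g20's one-layer small-rank criterion).  Reading: `p = 3`, `j = 2`: `ord₃ h(ℚ(√δ)·ℚ₂) ≤ 7` (the 11 imaginary mirrors of the K9 X3 census:
`e₂ ∈ {2,4,5}`, exact); `p = 5`, `j = 1`: `ord₅ h(ℚ(P′)·ℚ₁) ≤ 3` (the quartic character fields of the K8-t′ census: `e₁ ∈ {2,3}`, exact).  For an
imaginary `ℚ(χ_i)` with `p ∤ h(ℚ(χ_i)⁺·ℚ_j)` the displayed integer is `ord_p h⁻`, exact by the analytic class number formula.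
[cite: Fukuda1994, Thm. 1 (proof, p. 264)] [cite: Washington1997, §13.3 Prop. 13.22–13.23 and Thm. 4.17]
[cite: Greenberg2001IwasawaPastPresent, Prop. 2.1 p. 339] [cite: CoatesSujatha2005, §3 Thm. 3.4 and Cor. 3.6] -/
theorem fineSelmerDual_moduleFinite_of_not_irreducible_of_characterFields_iwasawa1956_or_classNumberPExp_lt {p : ℕ}
    [hp : Fact p.Prime] (hp2 : p ≠ 2) (W : WeierstrassCurve ℚ) [W.IsElliptic] (κ : ZpExtension ℚ p) (hκ : κ.IsCyclotomic)
    (C : AddSubgroup (W.geomTorsion ((p : ℕ) : ℤ)))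
    (hC : ∀ (σ : absoluteGaloisGroup ℚ) (x : W.geomTorsion ((p : ℕ) : ℤ)), x ∈ C → σ • x ∈ C) (h1 : C ≠ ⊥) (h2 : C ≠ ⊤)
    (j₁ j₂ : ℕ)
    (hK₁ : (¬ p ∣ Nat.card (ClassGroup (𝓞 ↥(fixedField (fixingSubgroup (absoluteGaloisGroup ℚ)
          (C : Set (W.geomTorsion ((p : ℕ) : ℤ)))) : IntermediateField ℚ (AlgebraicClosure ℚ)))) ∧
        ∃! v : HeightOneSpectrum (𝓞 ↥(fixedField (fixingSubgroup (absoluteGaloisGroup ℚ)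
          (C : Set (W.geomTorsion ((p : ℕ) : ℤ)))) : IntermediateField ℚ (AlgebraicClosure ℚ))),
          ((p : ℕ) : 𝓞 ↥(fixedField (fixingSubgroup (absoluteGaloisGroup ℚ)
          (C : Set (W.geomTorsion ((p : ℕ) : ℤ)))) : IntermediateField ℚ (AlgebraicClosure ℚ))) ∈ v.asIdeal) ∨
      ∀ κ₁ : ZpExtension ↥(fixedField (fixingSubgroup (absoluteGaloisGroup ℚ)
          (C : Set (W.geomTorsion ((p : ℕ) : ℤ)))) : IntermediateField ℚ (AlgebraicClosure ℚ)) p, κ₁.IsCyclotomic →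
        classNumberPExp κ₁ j₁ < p ^ j₁ - 1)
    (hK₂ : (¬ p ∣ Nat.card (ClassGroup (𝓞 ↥(fixedField (fixingSubgroup (absoluteGaloisGroup ℚ)
          (Set.range fun y : W.geomTorsion ((p : ℕ) : ℤ) => y +ᵥ (C : Set (W.geomTorsion ((p : ℕ) : ℤ))))) :
            IntermediateField ℚ (AlgebraicClosure ℚ)))) ∧
        ∃! v : HeightOneSpectrum (𝓞 ↥(fixedField (fixingSubgroup (absoluteGaloisGroup ℚ)
          (Set.range fun y : W.geomTorsion ((p : ℕ) : ℤ) => y +ᵥ (C : Set (W.geomTorsion ((p : ℕ) : ℤ))))) :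
            IntermediateField ℚ (AlgebraicClosure ℚ))),
          ((p : ℕ) : 𝓞 ↥(fixedField (fixingSubgroup (absoluteGaloisGroup ℚ)
          (Set.range fun y : W.geomTorsion ((p : ℕ) : ℤ) => y +ᵥ (C : Set (W.geomTorsion ((p : ℕ) : ℤ))))) :
            IntermediateField ℚ (AlgebraicClosure ℚ))) ∈ v.asIdeal) ∨
      ∀ κ₂ : ZpExtension ↥(fixedField (fixingSubgroup (absoluteGaloisGroup ℚ)
          (Set.range fun y : W.geomTorsion ((p : ℕ) : ℤ) => y +ᵥ (C : Set (W.geomTorsion ((p : ℕ) : ℤ))))) :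
            IntermediateField ℚ (AlgebraicClosure ℚ)) p, κ₂.IsCyclotomic →
        classNumberPExp κ₂ j₂ < p ^ j₂ - 1) :
    ∃ (γ : absoluteGaloisGroup ℚ) (D : W.FineSelmerDualData κ γ),
      Module.Finite ℤ_[p] (RestrictScalars ℤ_[p] (IwasawaAlgebra p) D.X) := by
  haveI : NeZero p := ⟨hp.out.ne_zero⟩
  -- the two canonical fixed fields are number fields (open subgroups of `Γ_ℚ` containing the Borel kernel)
  have hNopen : IsOpen (W.borelKernel C : Set (absoluteGaloisGroup ℚ)) := isOpen_borelKernel C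
  haveI : FiniteDimensional ℚ ↥(fixedField (fixingSubgroup (absoluteGaloisGroup ℚ)
          (C : Set (W.geomTorsion ((p : ℕ) : ℤ)))) : IntermediateField ℚ (AlgebraicClosure ℚ)) :=
    finiteDimensional_fixedField_of_isOpen _ (Subgroup.isOpen_mono borelKernel_le_fixingSubgroup_coe hNopen)
  haveI : FiniteDimensional ℚ ↥(fixedField (fixingSubgroup (absoluteGaloisGroup ℚ)
          (Set.range fun y : W.geomTorsion ((p : ℕ) : ℤ) => y +ᵥ (C : Set (W.geomTorsion ((p : ℕ) : ℤ))))) :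
            IntermediateField ℚ (AlgebraicClosure ℚ)) :=
    finiteDimensional_fixedField_of_isOpen _ (Subgroup.isOpen_mono (borelKernel_le_fixingSubgroup_cosets hC) hNopen)
  haveI : NumberField ↥(fixedField (fixingSubgroup (absoluteGaloisGroup ℚ)
          (C : Set (W.geomTorsion ((p : ℕ) : ℤ)))) : IntermediateField ℚ (AlgebraicClosure ℚ)) := NumberField.mk
  haveI : NumberField ↥(fixedField (fixingSubgroup (absoluteGaloisGroup ℚ)
          (Set.range fun y : W.geomTorsion ((p : ℕ) : ℤ) => y +ᵥ (C : Set (W.geomTorsion ((p : ℕ) : ℤ))))) :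
            IntermediateField ℚ (AlgebraicClosure ℚ)) := NumberField.mk
  refine fineSelmerDual_moduleFinite_of_not_irreducible_of_characterFields_doors hp2 W κ hκ C hC h1 h2 ?_ ?_
  · rcases hK₁ with h | h
    · exact Or.inl h
    · exact Or.inr (doors_of_classNumberPExp_lt_at j₁ h)
  · rcases hK₂ with h | h
    · exact Or.inl h
    · exact Or.inr (doors_of_classNumberPExp_lt_at j₂ h)

end Summit.BirchSwinnertonDyer.BirchSwinnertonDyer.Theorems.ReducibleFineSelmerRelativeClassNumber

end
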